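import Summits.KontsevichZagierPeriods.KontsevichZagierPeriods.Theses.TerasomaMultiplication
import Summits.KontsevichZagierPeriods.KontsevichZagierPeriods.Theorems.MultiplicationThree.Negative.Pinned
import Summits.KontsevichZagierPeriods.KontsevichZagierPeriods.Theorems.MultiplicationThree.Negative.BolzaLever
import Summits.KontsevichZagierPeriods.KontsevichZagierPeriods.Theorems.TerasomaMultiplicationMultiplicationThreeStubNegativeBranchToMaxCellImageAux
import Literature.NumberTheory.Transcendental.KZMellinFibres
import Literature.NumberTheory.Transcendental.KZSubcalculusInvariants
import Literature.NumberTheory.Transcendental.KZDominatedFamilyRelations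
import Literature.NumberTheory.Transcendental.KZLogCalculusProofs
import Literature.NumberTheory.Transcendental.KZSemialgebraicComplex
import Mathlib.Analysis.SpecialFunctions.Pow.Deriv

/-!
# `MultiplicationThree` (stmt-KontsevichZagierPeriods-3598), line `bolza-involution-real-quotient`:
# stub S4 — step (iii)a: the Möbius 2-torsion translation

Stub `stub_negativeBranchToMaxCellImage` of the crux `MultiplicationThree` (route `TerasomaMultiplication`; lead skeleton
`Cruxes/MultiplicationThree/Lines/bolza-involution-real-quotient.lean`).

On the level `u ∈ (0,1)` the elliptic curve `E_u : w² = Q(a,u) := a²(3−a)² − 4ua` has the rational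
`2`-torsion point `(a₁(u), 0)`, `a₁(u) ∈ (0,1)` the root of `a(3−a)² = 4u`; translation by it is the
Möbius involution `μ₁(a) = (3−a₁)(a−a₁)/(2a+a₁−3)` of the `a`-line, which maps the negative branch
`a < 0` onto the arc `a₁ < a < (3−a₁)/2` and preserves `da/√Q`. To keep every map rational we change
the base variable: `u = U(t) := t(3−t)²/4` is a polynomial bijection `(0,1) → (0,1)` and in the
coordinates `(t, a)` (`t = a₁`) the translation is `μ(t,a) = (3−t)(a−t)/(2a+t−3)` with the exact
Jacobian identity `Q(μ, U) = (∂μ/∂a)²·Q(a, U)` (auxiliary file `…StubNegativeBranchToMaxCellImageAux`).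
The stub is proved by TWO instances of rule (2) of the Kontsevich–Zagier calculus out of one
auxiliary representation `R₀ = [Σ', U(t)^{s−1} U′(t)/√Q(a,U(t))]`, `Σ' = {0<t<1, a<0}`: the
polynomial map `P(t,a) = (U(t), a)` (`|det| = U′(t)`) onto the negative branch, and the rational map
`PM(t,a) = (U(t), μ(t,a))` (`|det| = U′(t)|∂μ/∂a|`) onto the image cell
`{0<c, 0<a′, 2a′<3, 4c<a′(3−a′)², (a′≤1 ∨ c<a′²(3−2a′))}`; here: the Jacobians, the
`ℚ`-semialgebraicity of cells, maps and integrands (Euler–Mellin products), integrability transported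
along the maps by the Jacobian criterion, and the assembly. Every expression is written out
explicitly (no definitions, no notation); all helper names carry the prefix `s4_`.

References: M. Kontsevich, D. Zagier, *Periods* (2001), §1.2 rules (1), (2).
-/

noncomputable section

open Set MeasureTheory MvPolynomial
open Literature.NumberTheory.Transcendental Literature.NumberTheory.Transcendental.KZ
open Literature.ModelTheory.ExponentialFields (IsSemialgebraic)

namespace Summit.KontsevichZagierPeriods.TerasomaMultiplication.MultiplicationThreeBolza

open Summit.KontsevichZagierPeriods.TerasomaMultiplication.MultiplicationThreeNegative

/-! ### Jacobians -/

/-- `det DP = U′(t)`. [folklore] -/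
theorem s4_det_P' (y : Fin 2 → ℝ) : ((LinearMap.toContinuousLinearMap (Matrix.toLin' (!![(3 * (3 - y 0) * (1 - y 0) / 4), (0:ℝ); 0, 1] : Matrix (Fin 2) (Fin 2) ℝ)))).det = (3 * (3 - y 0) * (1 - y 0) / 4) := by
  change LinearMap.det (Matrix.toLin' (!![(3 * (3 - y 0) * (1 - y 0) / 4), (0:ℝ); 0, 1] : Matrix (Fin 2) (Fin 2) ℝ)) = _
  rw [LinearMap.det_toLin', Matrix.det_fin_two]
  simp

/-- `det DPM = U′(t) · ∂μ/∂a`. [folklore] -/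
theorem s4_det_PM' (y : Fin 2 → ℝ) : ((LinearMap.toContinuousLinearMap (Matrix.toLin' (!![(3 * (3 - y 0) * (1 - y 0) / 4), (0:ℝ); ((-2 * y 1 ^ 2 + 4 * y 1 * y 0 + y 0 ^ 2 - 6 * y 1 - 6 * y 0 + 9) / (2 * y 1 + y 0 - 3) ^ 2), (-(3 * (3 - y 0) * (1 - y 0)) / (2 * y 1 + y 0 - 3) ^ 2)] : Matrix (Fin 2) (Fin 2) ℝ)))).det = (3 * (3 - y 0) * (1 - y 0) / 4) * (-(3 * (3 - y 0) * (1 - y 0)) / (2 * y 1 + y 0 - 3) ^ 2) := by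
  change LinearMap.det (Matrix.toLin'
    (!![(3 * (3 - y 0) * (1 - y 0) / 4), (0:ℝ); ((-2 * y 1 ^ 2 + 4 * y 1 * y 0 + y 0 ^ 2 - 6 * y 1 - 6 * y 0 + 9) / (2 * y 1 + y 0 - 3) ^ 2), (-(3 * (3 - y 0) * (1 - y 0)) / (2 * y 1 + y 0 - 3) ^ 2)] : Matrix (Fin 2) (Fin 2) ℝ)) = _
  rw [LinearMap.det_toLin', Matrix.det_fin_two]
  simp

/-- `P` is differentiable with derivative `DP`. [folklore] -/
theorem s4_hasFDerivAt_P (y : Fin 2 → ℝ) : HasFDerivAt (fun y : Fin 2 → ℝ => (![(y 0 * (3 - y 0) ^ 2 / 4), y 1] : Fin 2 → ℝ)) ((LinearMap.toContinuousLinearMap (Matrix.toLin' (!![(3 * (3 - y 0) * (1 - y 0) / 4), (0:ℝ); 0, 1] : Matrix (Fin 2) (Fin 2) ℝ)))) y := by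
  have h0 : HasFDerivAt (fun z : Fin 2 → ℝ => z 0)
      (ContinuousLinearMap.proj (R := ℝ) (φ := fun _ : Fin 2 => ℝ) 0) y := hasFDerivAt_apply 0 y
  have h1 : HasFDerivAt (fun z : Fin 2 → ℝ => z 1)
      (ContinuousLinearMap.proj (R := ℝ) (φ := fun _ : Fin 2 => ℝ) 1) y := hasFDerivAt_apply 1 y
  have hU := (s4_hasDerivAt_U (y 0)).hasFDerivAt.comp y h0
  refine hasFDerivAt_pi'.2 (Fin.forall_fin_two.mpr ⟨?_, ?_⟩)
  · show HasFDerivAt (fun z : Fin 2 → ℝ => (z 0 * (3 - z 0) ^ 2 / 4)) _ y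
    refine hU.congr_fderiv (ContinuousLinearMap.ext fun v => ?_)
    simp [dotProduct, Fin.sum_univ_two, mul_comm]
  · show HasFDerivAt (fun z : Fin 2 → ℝ => z 1) _ y
    refine h1.congr_fderiv (ContinuousLinearMap.ext fun v => ?_)
    simp [dotProduct, Fin.sum_univ_two]

/-- `PM` is differentiable off `2a + t = 3` with derivative `DPM`. [folklore] -/
theorem s4_hasFDerivAt_PM {y : Fin 2 → ℝ} (hd : 2 * y 1 + y 0 - 3 ≠ 0) :
    HasFDerivAt (fun y : Fin 2 → ℝ => (![(y 0 * (3 - y 0) ^ 2 / 4), ((3 - y 0) * (y 1 - y 0) / (2 * y 1 + y 0 - 3))] : Fin 2 → ℝ)) ((LinearMap.toContinuousLinearMap (Matrix.toLin' (!![(3 * (3 - y 0) * (1 - y 0) / 4), (0:ℝ); ((-2 * y 1 ^ 2 + 4 * y 1 * y 0 + y 0 ^ 2 - 6 * y 1 - 6 * y 0 + 9) / (2 * y 1 + y 0 - 3) ^ 2), (-(3 * (3 - y 0) * (1 - y 0)) / (2 * y 1 + y 0 - 3) ^ 2)] : Matrix (Fin 2) (Fin 2) ℝ)))) y := by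
  have h0 : HasFDerivAt (fun z : Fin 2 → ℝ => z 0)
      (ContinuousLinearMap.proj (R := ℝ) (φ := fun _ : Fin 2 => ℝ) 0) y := hasFDerivAt_apply 0 y
  have h1 : HasFDerivAt (fun z : Fin 2 → ℝ => z 1)
      (ContinuousLinearMap.proj (R := ℝ) (φ := fun _ : Fin 2 => ℝ) 1) y := hasFDerivAt_apply 1 y
  have hU := (s4_hasDerivAt_U (y 0)).hasFDerivAt.comp y h0
  refine hasFDerivAt_pi'.2 (Fin.forall_fin_two.mpr ⟨?_, ?_⟩)
  · show HasFDerivAt (fun z : Fin 2 → ℝ => (z 0 * (3 - z 0) ^ 2 / 4)) _ y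
    refine hU.congr_fderiv (ContinuousLinearMap.ext fun v => ?_)
    simp [dotProduct, Fin.sum_univ_two, mul_comm]
  · show HasFDerivAt (fun z : Fin 2 → ℝ => ((3 - z 0) * (z 1 - z 0) / (2 * z 1 + z 0 - 3))) _ y
    have e : (fun z : Fin 2 → ℝ => ((3 - z 0) * (z 1 - z 0) / (2 * z 1 + z 0 - 3))) =
        fun z => (3 - z 0) * (z 1 - z 0) * (2 * z 1 + z 0 - 3)⁻¹ :=
      funext fun z => div_eq_mul_inv _ _
    rw [e]
    have hnum := (h0.const_sub 3).mul (h1.sub h0)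
    have hden := (hasFDerivAt_inv hd).comp y (((h1.const_mul 2).add h0).sub_const 3)
    refine (hnum.mul hden).congr_fderiv (ContinuousLinearMap.ext fun v => ?_)
    simp [dotProduct, Fin.sum_univ_two]
    field_simp
    ring

/-! ### Semialgebraicity -/

/-- `Σ'` is `ℚ`-semialgebraic. [folklore] -/
theorem s4_isSemialgebraic_neg : IsSemialgebraic ℚ {x : Fin 2 → ℝ | 0 < x 0 ∧ x 0 < 1 ∧ x 1 < 0} := by
  have h : {x : Fin 2 → ℝ | 0 < x 0 ∧ x 0 < 1 ∧ x 1 < 0} = {x | ∀ l, 0 < aeval x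
      ((![X 0, 1 - X 0, -X 1] : Fin 3 → MvPolynomial (Fin 2) ℚ) l)} := by
    ext x
    simp only [mem_setOf_eq, Fin.forall_fin_succ, Matrix.cons_val_zero, Matrix.cons_val_succ,
      map_sub, map_one, map_neg, MvPolynomial.aeval_X]
    constructor
    · rintro ⟨h0, h1, h2⟩; exact ⟨h0, by linarith, by linarith, fun i => Fin.elim0 i⟩
    · rintro ⟨h0, h1, h2, -⟩; exact ⟨h0, by linarith, by linarith⟩
  rw [h]; exact isSemialgebraic_setOf_forall_aeval_pos _

/-- The image cell is `ℚ`-semialgebraic. [folklore] -/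
theorem s4_isSemialgebraic_img : IsSemialgebraic ℚ {x : Fin 2 → ℝ | 0 < x 0 ∧ 0 < x 1 ∧ 2 * x 1 < 3 ∧ 4 * x 0 < x 1 * (3 - x 1) ^ 2 ∧ (x 1 ≤ 1 ∨ x 0 < x 1 ^ 2 * (3 - 2 * x 1))} := by
  have h : {x : Fin 2 → ℝ | 0 < x 0 ∧ 0 < x 1 ∧ 2 * x 1 < 3 ∧ 4 * x 0 < x 1 * (3 - x 1) ^ 2 ∧ (x 1 ≤ 1 ∨ x 0 < x 1 ^ 2 * (3 - 2 * x 1))} = {x | ∀ l, 0 < aeval x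
      ((![X 0, X 1, 3 - 2 * X 1, X 1 * (3 - X 1) ^ 2 - 4 * X 0] : Fin 4 → MvPolynomial (Fin 2) ℚ) l)} ∩
      ({x | aeval x (X 1 : MvPolynomial (Fin 2) ℚ) ≤ aeval x (1 : MvPolynomial (Fin 2) ℚ)} ∪
       {x | aeval x (X 0 : MvPolynomial (Fin 2) ℚ) <
          aeval x (X 1 ^ 2 * (3 - 2 * X 1) : MvPolynomial (Fin 2) ℚ)}) := by
    ext x
    simp only [mem_setOf_eq, mem_inter_iff, mem_union, Fin.forall_fin_succ,
      Matrix.cons_val_zero, Matrix.cons_val_succ, map_sub, map_mul, map_pow, map_one,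
      MvPolynomial.aeval_X, map_ofNat]
    constructor
    · rintro ⟨h0, h1, h2, h3, h4⟩
      exact ⟨⟨h0, h1, by linarith, by linarith, fun i => Fin.elim0 i⟩, h4⟩
    · rintro ⟨⟨h0, h1, h2, h3, -⟩, h4⟩
      exact ⟨h0, h1, by linarith, by linarith, h4⟩
  rw [h]
  exact (isSemialgebraic_setOf_forall_aeval_pos _).inter
    ((Literature.ModelTheory.ExponentialFields.isSemialgebraic_setOf_eval_le _ _).union
      (Literature.ModelTheory.ExponentialFields.isSemialgebraic_setOf_eval_lt _ _))

/-- `aeval` of the polynomial `U(X₀)`. [folklore] -/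
theorem s4_aeval_U (y : Fin 2 → ℝ) :
    aeval y (C (1/4 : ℚ) * X 0 * (3 - X 0) ^ 2 : MvPolynomial (Fin 2) ℚ) = (y 0 * (3 - y 0) ^ 2 / 4) := by
  simp only [map_mul, map_pow, map_sub, MvPolynomial.aeval_C, MvPolynomial.aeval_X, map_ofNat,
    eq_ratCast, Rat.cast_div, Rat.cast_one, Rat.cast_ofNat]
  ring

/-- `aeval` of the polynomial `Q(X₁, U(X₀))`. [folklore] -/
theorem s4_aeval_QP (y : Fin 2 → ℝ) :
    aeval y (X 1 ^ 2 * (3 - X 1) ^ 2 - X 0 * (3 - X 0) ^ 2 * X 1 : MvPolynomial (Fin 2) ℚ) =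
      y 1 ^ 2 * (3 - y 1) ^ 2 - 4 * (y 0 * (3 - y 0) ^ 2 / 4) * y 1 := by
  simp only [map_mul, map_pow, map_sub, MvPolynomial.aeval_X, map_ofNat]
  ring

/-- `aeval` of the polynomial `Q(X₀, X₁)`. [folklore] -/
theorem s4_aeval_Q (x : Fin 2 → ℝ) :
    aeval x (X 1 ^ 2 * (3 - X 1) ^ 2 - 4 * X 0 * X 1 : MvPolynomial (Fin 2) ℚ) =
      x 1 ^ 2 * (3 - x 1) ^ 2 - 4 * x 0 * x 1 := by
  simp only [map_mul, map_pow, map_sub, MvPolynomial.aeval_X, map_ofNat]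

/-- `aeval` of the polynomial `U′(X₀)`. [folklore] -/
theorem s4_aeval_dU (y : Fin 2 → ℝ) :
    aeval y (C (3/4 : ℚ) * (3 - X 0) * (1 - X 0) : MvPolynomial (Fin 2) ℚ) = (3 * (3 - y 0) * (1 - y 0) / 4) := by
  simp only [map_mul, map_sub, map_one, MvPolynomial.aeval_C, MvPolynomial.aeval_X, map_ofNat,
    eq_ratCast, Rat.cast_div, Rat.cast_ofNat]
  ring

/-- `y ↦ U(y₀)` is `ℚ`-semialgebraic on `Σ'` (a polynomial). [folklore] -/
theorem s4_isSemialgebraicFunOn_U0 : IsSemialgebraicFunOn ℚ {x : Fin 2 → ℝ | 0 < x 0 ∧ x 0 < 1 ∧ x 1 < 0} (fun y => (y 0 * (3 - y 0) ^ 2 / 4)) :=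
  (isSemialgebraicFunOn_aeval s4_isSemialgebraic_neg _).congr fun y _ => s4_aeval_U y

/-- `P` is a `ℚ`-semialgebraic map on `Σ'`. [folklore] -/
theorem s4_isSemialgebraicMapOn_P : IsSemialgebraicMapOn ℚ {x : Fin 2 → ℝ | 0 < x 0 ∧ x 0 < 1 ∧ x 1 < 0} (fun y : Fin 2 → ℝ => (![(y 0 * (3 - y 0) ^ 2 / 4), y 1] : Fin 2 → ℝ)) :=
  IsSemialgebraicMapOn.of_forall s4_isSemialgebraic_neg (Fin.forall_fin_two.mpr
    ⟨s4_isSemialgebraicFunOn_U0,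
     (isSemialgebraicFunOn_aeval s4_isSemialgebraic_neg (X 1)).congr fun y _ => by simp⟩)

/-- `PM` is a `ℚ`-semialgebraic map on `Σ'` (rational, denominator `2a + t − 3 ≠ 0`). [folklore] -/
theorem s4_isSemialgebraicMapOn_PM : IsSemialgebraicMapOn ℚ {x : Fin 2 → ℝ | 0 < x 0 ∧ x 0 < 1 ∧ x 1 < 0} (fun y : Fin 2 → ℝ => (![(y 0 * (3 - y 0) ^ 2 / 4), ((3 - y 0) * (y 1 - y 0) / (2 * y 1 + y 0 - 3))] : Fin 2 → ℝ)) := by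
  refine IsSemialgebraicMapOn.of_forall s4_isSemialgebraic_neg (Fin.forall_fin_two.mpr
    ⟨s4_isSemialgebraicFunOn_U0, ?_⟩)
  refine ((isSemialgebraicFunOn_aeval_div_aeval s4_isSemialgebraic_neg
    ((3 - X 0) * (X 1 - X 0) : MvPolynomial (Fin 2) ℚ) (2 * X 1 + X 0 - 3) fun y hy => ?_).congr
    fun y _ => ?_)
  · simp only [map_sub, map_add, map_mul, MvPolynomial.aeval_X, map_ofNat]
    exact s4_den_ne hy
  · simp only [map_sub, map_add, map_mul, MvPolynomial.aeval_X, map_ofNat, Matrix.cons_val_one,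
      Matrix.cons_val_zero]

/-- `q^{−1/2} = 1/√q` for `q ≥ 0`. [folklore] -/
theorem s4_rpow_neg_half {q : ℝ} (hq : 0 ≤ q) : q ^ (-(1:ℝ) / 2) = (Real.sqrt q)⁻¹ := by
  rw [Real.sqrt_eq_rpow, ← Real.rpow_neg hq, neg_div]

/-- The auxiliary integrand `F(t,a) = U(t)^{s−1} U′(t)/√Q(a, U(t))` is `ℚ`-semialgebraic on `Σ'`
(an Euler–Mellin product times a polynomial). [folklore] -/
theorem s4_isSemialgebraicFunOn_F (s : ℚ) :
    IsSemialgebraicFunOn ℚ {x : Fin 2 → ℝ | 0 < x 0 ∧ x 0 < 1 ∧ x 1 < 0} (fun y : Fin 2 → ℝ => ((y 0 * (3 - y 0) ^ 2 / 4) ^ ((s:ℝ) - 1) / Real.sqrt (y 1 ^ 2 * (3 - y 1) ^ 2 - 4 * (y 0 * (3 - y 0) ^ 2 / 4) * y 1) * (3 * (3 - y 0) * (1 - y 0) / 4))) := by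
  have hmel := isSemialgebraicFunOn_mellinIntegrand s4_isSemialgebraic_neg
    (![C (1/4 : ℚ) * X 0 * (3 - X 0) ^ 2, X 1 ^ 2 * (3 - X 1) ^ 2 - X 0 * (3 - X 0) ^ 2 * X 1] :
      Fin 2 → MvPolynomial (Fin 2) ℚ) ![s - 1, -1/2] 1 ?_
  · have hdU := isSemialgebraicFunOn_aeval s4_isSemialgebraic_neg
      (C (3/4 : ℚ) * (3 - X 0) * (1 - X 0) : MvPolynomial (Fin 2) ℚ)
    refine (IsSemialgebraicFunOn.mul_holds hmel hdU).congr fun y hy => ?_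
    have hQ := s4_QP_pos hy
    simp only [Pi.mul_apply, mellinIntegrand, Fin.prod_univ_two, Matrix.cons_val_zero,
      Matrix.cons_val_one, s4_aeval_U, s4_aeval_QP, s4_aeval_dU, Rat.cast_sub, Rat.cast_one,
      Rat.cast_div, Rat.cast_neg, Rat.cast_ofNat, s4_rpow_neg_half hQ.le]
    ring
  · intro y hy k
    fin_cases k
    · simp only [Fin.zero_eta, Matrix.cons_val_zero, s4_aeval_U]
      exact (s4_U_mem hy.1 hy.2.1).1
    · simp only [Fin.mk_one, Matrix.cons_val_one, Matrix.cons_val_zero, s4_aeval_QP]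
      exact s4_QP_pos hy

/-- The pinned integrand `c^{s−1}/√Q` is `ℚ`-semialgebraic on the image cell. [folklore] -/
theorem s4_isSemialgebraicFunOn_f (s : ℚ) :
    IsSemialgebraicFunOn ℚ {x : Fin 2 → ℝ | 0 < x 0 ∧ 0 < x 1 ∧ 2 * x 1 < 3 ∧ 4 * x 0 < x 1 * (3 - x 1) ^ 2 ∧ (x 1 ≤ 1 ∨ x 0 < x 1 ^ 2 * (3 - 2 * x 1))} (fun x : Fin 2 → ℝ => (x 0 ^ ((s:ℝ) - 1) / Real.sqrt (x 1 ^ 2 * (3 - x 1) ^ 2 - 4 * x 0 * x 1))) := by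
  refine (isSemialgebraicFunOn_mellinIntegrand s4_isSemialgebraic_img
    (![X 0, X 1 ^ 2 * (3 - X 1) ^ 2 - 4 * X 0 * X 1] : Fin 2 → MvPolynomial (Fin 2) ℚ)
    ![s - 1, -1/2] 1 ?_).congr fun x hx => ?_
  · intro x hx k
    fin_cases k
    · simp only [Fin.zero_eta, Matrix.cons_val_zero, MvPolynomial.aeval_X]
      exact hx.1
    · simp only [Fin.mk_one, Matrix.cons_val_one, Matrix.cons_val_zero, s4_aeval_Q]
      exact s4_Q_pos_img hx
  · have hQ := s4_Q_pos_img hx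
    simp only [mellinIntegrand, Fin.prod_univ_two, Matrix.cons_val_zero, Matrix.cons_val_one,
      MvPolynomial.aeval_X, s4_aeval_Q, Rat.cast_sub, Rat.cast_one, Rat.cast_div, Rat.cast_neg,
      Rat.cast_ofNat, s4_rpow_neg_half hQ.le]
    ring

/-! ### The two rule-(2) moves -/

/-- **The rule-(2) integrand relation of `PM`**: `F(t,a) = f(PM(t,a))·|det DPM|` on `Σ'`
(`√Q(μ,U) = |∂μ/∂a| √Q(a,U)`). [folklore] -/
theorem s4_F_eq_jac (s : ℚ) {y : Fin 2 → ℝ} (hy : y ∈ {x : Fin 2 → ℝ | 0 < x 0 ∧ x 0 < 1 ∧ x 1 < 0}) :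
    ((y 0 * (3 - y 0) ^ 2 / 4) ^ ((s:ℝ) - 1) / Real.sqrt (y 1 ^ 2 * (3 - y 1) ^ 2 - 4 * (y 0 * (3 - y 0) ^ 2 / 4) * y 1) * (3 * (3 - y 0) * (1 - y 0) / 4)) = (y 0 * (3 - y 0) ^ 2 / 4) ^ ((s:ℝ) - 1) /
      Real.sqrt (((3 - y 0) * (y 1 - y 0) / (2 * y 1 + y 0 - 3)) ^ 2 * (3 - ((3 - y 0) * (y 1 - y 0) / (2 * y 1 + y 0 - 3))) ^ 2 - 4 * (y 0 * (3 - y 0) ^ 2 / 4) * ((3 - y 0) * (y 1 - y 0) / (2 * y 1 + y 0 - 3))) *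
        |((LinearMap.toContinuousLinearMap (Matrix.toLin' (!![(3 * (3 - y 0) * (1 - y 0) / 4), (0:ℝ); ((-2 * y 1 ^ 2 + 4 * y 1 * y 0 + y 0 ^ 2 - 6 * y 1 - 6 * y 0 + 9) / (2 * y 1 + y 0 - 3) ^ 2), (-(3 * (3 - y 0) * (1 - y 0)) / (2 * y 1 + y 0 - 3) ^ 2)] : Matrix (Fin 2) (Fin 2) ℝ)))).det| := by
  have hQ := s4_QP_pos hy
  obtain ⟨ht0, ht1, ha⟩ := hy
  have hd : 2 * y 1 + y 0 - 3 ≠ 0 := (show 2 * y 1 + y 0 - 3 < 0 by linarith).ne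
  have hdU : 0 < (3 * (3 - y 0) * (1 - y 0) / 4) := s4_dU_pos ht1
  have hmua : (-(3 * (3 - y 0) * (1 - y 0)) / (2 * y 1 + y 0 - 3) ^ 2) ≠ 0 :=
    div_ne_zero (neg_ne_zero.2 (mul_pos (mul_pos three_pos (by linarith)) (by linarith)).ne')
      (pow_ne_zero 2 hd)
  rw [s4_det_PM', abs_mul, abs_of_pos hdU, s4_Q_PM hd, Real.sqrt_mul' _ hQ.le, Real.sqrt_sq_eq_abs]
  have h1 : Real.sqrt (y 1 ^ 2 * (3 - y 1) ^ 2 - 4 * (y 0 * (3 - y 0) ^ 2 / 4) * y 1) ≠ 0 := (Real.sqrt_pos.2 hQ).ne'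
  have h2 : |(-(3 * (3 - y 0) * (1 - y 0)) / (2 * y 1 + y 0 - 3) ^ 2)| ≠ 0 := abs_ne_zero.2 hmua
  revert h1 h2
  generalize Real.sqrt (y 1 ^ 2 * (3 - y 1) ^ 2 - 4 * (y 0 * (3 - y 0) ^ 2 / 4) * y 1) = S
  generalize |(-(3 * (3 - y 0) * (1 - y 0)) / (2 * y 1 + y 0 - 3) ^ 2)| = m
  intro h1 h2
  field_simp

/-- **Move A** (rule 2 along `P`): `[R₀] − [r] ∈ changeOfVariablesRel` for `R₀` pinned to `F` on `Σ'`
and every `r` pinned to `f` on `Σ_neg`. [folklore] -/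
theorem s4_moveA {s : ℚ} (R₀ r : IntegralRep 2) (hR : R₀.domain = {x : Fin 2 → ℝ | 0 < x 0 ∧ x 0 < 1 ∧ x 1 < 0})
    (hRi : EqOn R₀.integrand (fun y : Fin 2 → ℝ => ((y 0 * (3 - y 0) ^ 2 / 4) ^ ((s:ℝ) - 1) / Real.sqrt (y 1 ^ 2 * (3 - y 1) ^ 2 - 4 * (y 0 * (3 - y 0) ^ 2 / 4) * y 1) * (3 * (3 - y 0) * (1 - y 0) / 4))) R₀.domain) (hr : r.domain = {x : Fin 2 → ℝ | 0 < x 0 ∧ x 0 < 1 ∧ x 1 < 0})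
    (hri : EqOn r.integrand (fun x : Fin 2 → ℝ => (x 0 ^ ((s:ℝ) - 1) / Real.sqrt (x 1 ^ 2 * (3 - x 1) ^ 2 - 4 * x 0 * x 1))) r.domain) :
    of R₀ - of r ∈ changeOfVariablesRel := by
  refine ⟨2, R₀, r, (fun y : Fin 2 → ℝ => (![(y 0 * (3 - y 0) ^ 2 / 4), y 1] : Fin 2 → ℝ)), fun y => (LinearMap.toContinuousLinearMap (Matrix.toLin' (!![(3 * (3 - y 0) * (1 - y 0) / 4), (0:ℝ); 0, 1] : Matrix (Fin 2) (Fin 2) ℝ))), ?_, ?_, ?_, ?_, fun y hy => ?_, rfl⟩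
  · rw [hR]; exact s4_isSemialgebraicMapOn_P
  · rw [hR]; exact fun y _ => (s4_hasFDerivAt_P y).hasFDerivWithinAt
  · rw [hR]; exact s4_injOn_P
  · rw [hr, hR, s4_image_P]
  · have hy' : y ∈ {x : Fin 2 → ℝ | 0 < x 0 ∧ x 0 < 1 ∧ x 1 < 0} := by rw [← hR]; exact hy
    rw [hRi hy, hri (by rw [hr]; exact s4_mapsTo_P hy')]
    simp only [Matrix.cons_val_zero, Matrix.cons_val_one]
    rw [s4_det_P', abs_of_pos (s4_dU_pos hy'.2.1)]

/-- **Move B** (rule 2 along `PM`): `[R₀] − [ρ] ∈ changeOfVariablesRel` for `R₀` pinned to `F` on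
`Σ'` and every `ρ` pinned to `f` on the image cell. [folklore] -/
theorem s4_moveB {s : ℚ} (R₀ ρ : IntegralRep 2) (hR : R₀.domain = {x : Fin 2 → ℝ | 0 < x 0 ∧ x 0 < 1 ∧ x 1 < 0})
    (hRi : EqOn R₀.integrand (fun y : Fin 2 → ℝ => ((y 0 * (3 - y 0) ^ 2 / 4) ^ ((s:ℝ) - 1) / Real.sqrt (y 1 ^ 2 * (3 - y 1) ^ 2 - 4 * (y 0 * (3 - y 0) ^ 2 / 4) * y 1) * (3 * (3 - y 0) * (1 - y 0) / 4))) R₀.domain) (hρ : ρ.domain = {x : Fin 2 → ℝ | 0 < x 0 ∧ 0 < x 1 ∧ 2 * x 1 < 3 ∧ 4 * x 0 < x 1 * (3 - x 1) ^ 2 ∧ (x 1 ≤ 1 ∨ x 0 < x 1 ^ 2 * (3 - 2 * x 1))})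
    (hρi : EqOn ρ.integrand (fun x : Fin 2 → ℝ => (x 0 ^ ((s:ℝ) - 1) / Real.sqrt (x 1 ^ 2 * (3 - x 1) ^ 2 - 4 * x 0 * x 1))) ρ.domain) :
    of R₀ - of ρ ∈ changeOfVariablesRel := by
  refine ⟨2, R₀, ρ, (fun y : Fin 2 → ℝ => (![(y 0 * (3 - y 0) ^ 2 / 4), ((3 - y 0) * (y 1 - y 0) / (2 * y 1 + y 0 - 3))] : Fin 2 → ℝ)), fun y => (LinearMap.toContinuousLinearMap (Matrix.toLin' (!![(3 * (3 - y 0) * (1 - y 0) / 4), (0:ℝ); ((-2 * y 1 ^ 2 + 4 * y 1 * y 0 + y 0 ^ 2 - 6 * y 1 - 6 * y 0 + 9) / (2 * y 1 + y 0 - 3) ^ 2), (-(3 * (3 - y 0) * (1 - y 0)) / (2 * y 1 + y 0 - 3) ^ 2)] : Matrix (Fin 2) (Fin 2) ℝ))), ?_, ?_, ?_, ?_, fun y hy => ?_, rfl⟩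
  · rw [hR]; exact s4_isSemialgebraicMapOn_PM
  · rw [hR]; exact fun y hy => (s4_hasFDerivAt_PM (s4_den_ne hy)).hasFDerivWithinAt
  · rw [hR]; exact s4_injOn_PM
  · rw [hρ, hR, s4_image_PM]
  · have hy' : y ∈ {x : Fin 2 → ℝ | 0 < x 0 ∧ x 0 < 1 ∧ x 1 < 0} := by rw [← hR]; exact hy
    rw [hRi hy, hρi (by rw [hρ]; exact s4_mapsTo_PM hy')]
    simp only [Matrix.cons_val_zero, Matrix.cons_val_one]
    exact s4_F_eq_jac s hy'

/-- Integrability of the auxiliary integrand on `Σ'`, transported from the pinned `r` along `P`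
(Jacobian criterion). [folklore] -/
theorem s4_integrableOn_F {s : ℚ} (r : IntegralRep 2) (hr : r.domain = {x : Fin 2 → ℝ | 0 < x 0 ∧ x 0 < 1 ∧ x 1 < 0})
    (hri : EqOn r.integrand (fun x : Fin 2 → ℝ => (x 0 ^ ((s:ℝ) - 1) / Real.sqrt (x 1 ^ 2 * (3 - x 1) ^ 2 - 4 * x 0 * x 1))) r.domain) :
    IntegrableOn (fun y : Fin 2 → ℝ => ((y 0 * (3 - y 0) ^ 2 / 4) ^ ((s:ℝ) - 1) / Real.sqrt (y 1 ^ 2 * (3 - y 1) ^ 2 - 4 * (y 0 * (3 - y 0) ^ 2 / 4) * y 1) * (3 * (3 - y 0) * (1 - y 0) / 4))) {x : Fin 2 → ℝ | 0 < x 0 ∧ x 0 < 1 ∧ x 1 < 0} volume := by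
  have hmeas : MeasurableSet {x : Fin 2 → ℝ | 0 < x 0 ∧ x 0 < 1 ∧ x 1 < 0} := IsSemialgebraic.measurableSet_holds s4_isSemialgebraic_neg
  have h := (integrableOn_image_iff_integrableOn_abs_det_fderiv_smul volume hmeas
    (fun y _ => (s4_hasFDerivAt_P y).hasFDerivWithinAt) s4_injOn_P r.integrand).mp
    (by rw [s4_image_P, ← hr]; exact r.integrableOn)
  refine h.congr_fun (fun y hy => ?_) hmeas
  dsimp only
  rw [s4_det_P', abs_of_pos (s4_dU_pos hy.2.1), smul_eq_mul, hri (by rw [hr]; exact s4_mapsTo_P hy)]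
  simp only [Matrix.cons_val_zero, Matrix.cons_val_one]
  ring

/-- Integrability of the pinned integrand on the image cell, transported from the auxiliary
integrand along `PM`. [folklore] -/
theorem s4_integrableOn_f {s : ℚ} (hF : IntegrableOn (fun y : Fin 2 → ℝ => ((y 0 * (3 - y 0) ^ 2 / 4) ^ ((s:ℝ) - 1) / Real.sqrt (y 1 ^ 2 * (3 - y 1) ^ 2 - 4 * (y 0 * (3 - y 0) ^ 2 / 4) * y 1) * (3 * (3 - y 0) * (1 - y 0) / 4))) {x : Fin 2 → ℝ | 0 < x 0 ∧ x 0 < 1 ∧ x 1 < 0} volume) :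
    IntegrableOn (fun x : Fin 2 → ℝ => (x 0 ^ ((s:ℝ) - 1) / Real.sqrt (x 1 ^ 2 * (3 - x 1) ^ 2 - 4 * x 0 * x 1))) {x : Fin 2 → ℝ | 0 < x 0 ∧ 0 < x 1 ∧ 2 * x 1 < 3 ∧ 4 * x 0 < x 1 * (3 - x 1) ^ 2 ∧ (x 1 ≤ 1 ∨ x 0 < x 1 ^ 2 * (3 - 2 * x 1))} volume := by
  have hmeas : MeasurableSet {x : Fin 2 → ℝ | 0 < x 0 ∧ x 0 < 1 ∧ x 1 < 0} := IsSemialgebraic.measurableSet_holds s4_isSemialgebraic_neg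
  rw [← s4_image_PM, integrableOn_image_iff_integrableOn_abs_det_fderiv_smul volume hmeas
    (fun y hy => (s4_hasFDerivAt_PM (s4_den_ne hy)).hasFDerivWithinAt) s4_injOn_PM]
  refine hF.congr_fun (fun y hy => ?_) hmeas
  dsimp only
  rw [smul_eq_mul, s4_F_eq_jac s hy, mul_comm]
  simp only [Matrix.cons_val_zero, Matrix.cons_val_one]

/-- Step (iii)a of the Bolza line: translation by the rational `2`-torsion point `(a₁(u), 0)` of
`E_u : w² = a²(3−a)² − 4ua`, realised in the coordinates `(t, a)`, `u = t(3−t)²/4`, by the two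
rule-(2) maps `P(t,a) = (u, a)` and `PM(t,a) = (u, (3−t)(a−t)/(2a+t−3))` out of the auxiliary
representation `R₀ = [Σ', F]`: `[Σ_neg, f] ~ [R₀] ~ [maxCellImage, f]`, `f = u^{s−1}/√Q`. [folklore] -/
theorem stub_negativeBranchToMaxCellImage :
    ∀ s : ℚ, 0 < s → ∀ (r : Literature.NumberTheory.Transcendental.KZ.IntegralRep 2), r.domain = {x | 0 < x 0 ∧ x 0 < 1 ∧ x 1 < 0} → Set.EqOn r.integrand (fun x => (x 0) ^ ((s:ℝ) - 1) / Real.sqrt ((x 1) ^ 2 * (3 - x 1) ^ 2 - 4 * x 0 * x 1)) r.domain → (∃ ρ : Literature.NumberTheory.Transcendental.KZ.IntegralRep 2, ρ.domain = {x | 0 < x 0 ∧ 0 < x 1 ∧ 2 * x 1 < 3 ∧ 4 * x 0 < x 1 * (3 - x 1) ^ 2 ∧ (x 1 ≤ 1 ∨ x 0 < x 1 ^ 2 * (3 - 2 * x 1))} ∧ Set.EqOn ρ.integrand (fun x => (x 0) ^ ((s:ℝ) - 1) / Real.sqrt ((x 1) ^ 2 * (3 - x 1) ^ 2 - 4 *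 x 0 * x 1)) ρ.domain) ∧ ∀ (ρ : Literature.NumberTheory.Transcendental.KZ.IntegralRep 2), ρ.domain = {x | 0 < x 0 ∧ 0 < x 1 ∧ 2 * x 1 < 3 ∧ 4 * x 0 < x 1 * (3 - x 1) ^ 2 ∧ (x 1 ≤ 1 ∨ x 0 < x 1 ^ 2 * (3 - 2 * x 1))} → Set.EqOn ρ.integrand (fun x => (x 0) ^ ((s:ℝ) - 1) / Real.sqrt ((x 1) ^ 2 * (3 - x 1) ^ 2 - 4 * x 0 * x 1)) ρ.domain → Literature.NumberTheory.Transcendental.KZ.Equivalent r ρ := by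
  intro s _ r hr hri
  have hF := s4_integrableOn_F r hr hri
  set R₀ : IntegralRep 2 :=
    ⟨{x : Fin 2 → ℝ | 0 < x 0 ∧ x 0 < 1 ∧ x 1 < 0}, fun y => ((y 0 * (3 - y 0) ^ 2 / 4) ^ ((s:ℝ) - 1) / Real.sqrt (y 1 ^ 2 * (3 - y 1) ^ 2 - 4 * (y 0 * (3 - y 0) ^ 2 / 4) * y 1) * (3 * (3 - y 0) * (1 - y 0) / 4)), s4_isSemialgebraic_neg, s4_isSemialgebraicFunOn_F s, hF⟩
  have hf := s4_integrableOn_f hF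
  refine ⟨⟨⟨{x : Fin 2 → ℝ | 0 < x 0 ∧ 0 < x 1 ∧ 2 * x 1 < 3 ∧ 4 * x 0 < x 1 * (3 - x 1) ^ 2 ∧ (x 1 ≤ 1 ∨ x 0 < x 1 ^ 2 * (3 - 2 * x 1))}, fun x => (x 0 ^ ((s:ℝ) - 1) / Real.sqrt (x 1 ^ 2 * (3 - x 1) ^ 2 - 4 * x 0 * x 1)), s4_isSemialgebraic_img, s4_isSemialgebraicFunOn_f s, hf⟩, rfl,
    fun _ _ => rfl⟩, fun ρ hρ hρi => ?_⟩
  have hA : Equivalent R₀ r :=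
    changeOfVariablesRel_subset_relations (s4_moveA R₀ r rfl (fun _ _ => rfl) hr hri)
  have hB : Equivalent R₀ ρ :=
    changeOfVariablesRel_subset_relations (s4_moveB R₀ ρ rfl (fun _ _ => rfl) hρ hρi)
  exact hA.symm.trans hB

end Summit.KontsevichZagierPeriods.TerasomaMultiplication.MultiplicationThreeBolza

end
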